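import Literature.AlgebraicGeometry.Deformation.SchlessingerH4OfFreeAction
import Literature.AlgebraicGeometry.Deformation.T1LiftingAuxiliaryAlgebras
import Literature.AlgebraicGeometry.Deformation.LocalHilbertFunctorTangentSpaceNormalSheaf
import HarnessLib

/-!
# Quotients of a small extension by subspaces of its kernel; coordinate lines

[Hartshorne2010, §11, Definition (obstruction theory), condition (b)] asks for compatibility of obstructions with the
passage from an extension `0 → J → C′ → C → 0` to the QUOTIENT extension `0 → J/K → C′/K → C → 0` for a subspace
`K ⊆ J` («the natural map `V ⊗ J → V ⊗ J/K`»); [Manetti1999DeformationTheoryDGLA, Def. 2.12 (2)] /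
[FantechiManetti1999T1Lifting, Def. 0.1] ask for compatibility with ALL morphisms of small extensions. The reduction of
the second to the first (and to the coordinate lines `k[ε] → k[J]`, `a + bε ↦ a + b i`, of [Schlessinger1968, (2.17)])
is pure algebra, recorded here for the tree's `Art_k` (`ArtAlg`), in the vocabulary of `ArtAlg.kerSubmodule`,
`ArtAlg.sqZeroKer`, `ArtAlg.sqZeroKerMap`, `ArtAlg.ofQuotient`:

* §1 for `p : R₁ → R₀` with `ker p · 𝔪 = 0`, every `k`-subspace `K ⊆ ker p` is an IDEAL (`ArtAlg.kerSubspaceIdeal`: `𝔪`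
  acts on `ker p` through `k`);
* §2 the quotient datum `p_K : R₁/K → R₀` (`ArtAlg.kerQuot`, `kerQuotMk`, `kerQuotLift`): again `ker · 𝔪 = 0`,
  surjective when `p` is, `IsSmallExt` when `p` is; its kernel is `ker p / K` (`kerQuotKerMap`, surjective, kernel `K`);
* §3 `K = ker w` for a functional `w` on `ker p` with `w t = 1` (`ArtAlg.fnlKer`, `fnlQuot…`): the quotient datum is a
  PRINCIPAL small extension (`isSmallExtension_fnlQuotLift`) generated by the class `t̄` (`fnlGen`), and the class of
  `j ∈ ker p` is `w(j) · t̄` (`fnlQuotMk_coe_eq_smul`) — the shape `α t₁ = c · t₂` consumed by the base-change lemmas of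
  the `H_Z^X` obstruction (`LocalHilbertFunctorNormalObstructionBaseChange`);
* §4 functoriality: a morphism of surjection data `(α, ᾱ) : p → p′` with `α(K) ⊆ K′` descends to the quotients
  (`kerQuotMap`, both squares); for functionals `w′ ∘ g` and `w′` the descended map sends `t̄₁ ↦ w′(g t₁) · t̄₂`
  (`fnlQuotMap_coe_fnlGen`); when `α` kills `ker p` the square `p → p′_K′` has ZERO kernel map;
* §5 squares: `k[J″ → J′ → J] = k[J′ → J] ∘ k[J″ → J′]` (`sqZeroKerMap_comp`), and a square whose kernel map vanishes
  induces `k[J′] → k → k[J]` (`sqZeroKerMap_eq_inl_comp_aug`);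
* §6 the coordinate line `λ_i : k[ε] → R₁`, `a + bε ↦ a + b i` through `i ∈ ker p` as a morphism of surjection data over
  `k → R₀` (`ArtAlg.kerLineHom`, `kerLineHom_sq`), `k[λ_i] ∘ (k[ε] ≅ k[kε]) = ` Schlessinger's line (`sqZeroKerLine`),
  the scalings `σ_c : ε ↦ cε` (`ArtAlg.epsScale`, `λ_i ∘ σ_c = λ_{c i}`), and the generator relations of the composites
  `R₁/ker w ← R₁ ← k[ε]` (`ε ↦ w(i) · t̄`).

HONEST SCOPE. Algebra only (no functor, no scheme): these are the morphisms of small extensions along which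
[Hartshorne2010, Thm. 6.2 (b)]'s obstruction `H¹(𝒩 ⊗ J) = H¹(𝒩) ⊗ J` is decomposed into its principal coordinates.
Nothing here concerns a Hodge-type statement.

## References
* [Hartshorne2010] R. Hartshorne, *Deformation Theory*, GTM 257 (2010): §11 Definition (b) (quotient extensions `C′/K`).
* [Manetti1999DeformationTheoryDGLA] M. Manetti, Deformation theory via differential graded Lie algebras (1999): Def. 2.12.
* [FantechiManetti1999T1Lifting] B. Fantechi, M. Manetti, On the `T¹`-lifting theorem, J. Algebraic Geom. 8 (1999): §0, Def. 0.1.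
* [Schlessinger1968] M. Schlessinger, Functors of Artin rings, Trans. AMS 130 (1968): Def. 1.2, Lemma 2.10, (2.16)–(2.17).
* [StacksProject] The Stacks Project, Tags 06GC, 06GD (small extensions and quotients in `𝒞_Λ`).
-/

universe u

namespace Literature.AlgebraicGeometry.Deformation

open IsLocalRing

/-! ## §1 Subspaces of the kernel of a small surjection are ideals -/

section KerSubspace

variable {k : Type u} [Field k] {R₀ R₁ : ArtAlg.{u} k} (p : R₁ →ₐ[k] R₀) (hI : RingHom.ker p * maximalIdeal R₁ = ⊥)
  (K : Submodule k ↥R₁) (hK : K ≤ ArtAlg.kerSubmodule p)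

include hI hK in
/-- `𝔪 · ker p = 0` makes `R₁` act on `ker p` through the residue field: `r · x = r̄ · x` for `x ∈ ker p`, so every
`k`-subspace `K ⊆ ker p` is stable under `R₁`. [cite: Hartshorne2010, §11 Definition (b) («`K ⊆ J` a subspace»)]
[cite: Schlessinger1968, Def. 1.2] -/
theorem ArtAlg.mul_mem_kerSubspace (r x : ↥R₁) (hx : x ∈ K) : r * x ∈ K := by
  have hr : r - algebraMap k R₁ (R₁.residue r) ∈ maximalIdeal R₁ := by
    rw [← ArtAlg.ker_augmentation_eq_maximalIdeal R₁ R₁.residue, RingHom.mem_ker]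
    change R₁.residue (r - algebraMap k R₁ (R₁.residue r)) = 0
    rw [map_sub, AlgHom.commutes, Algebra.algebraMap_self, RingHom.id_apply, sub_self]
  have hxk : (x : ↥R₁) ∈ RingHom.ker p := (ArtAlg.mem_kerSubmodule p x).1 (hK hx)
  have h0 : (r - algebraMap k R₁ (R₁.residue r)) * x = 0 := by
    have h := Ideal.mul_mem_mul hxk hr
    rw [hI, Ideal.mem_bot] at h
    rw [mul_comm]
    exact h
  have hrx : r * x = R₁.residue r • x := by
    rw [Algebra.smul_def, ← sub_eq_zero, ← sub_mul, h0]
  rw [hrx]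
  exact K.smul_mem _ hx

/-- **A subspace `K ⊆ ker p` as an ideal of `R₁`** (for `ker p · 𝔪 = 0`). Definition with body.
[cite: Hartshorne2010, §11 Definition (b)] [cite: StacksProject, Tag 06GD] -/
def ArtAlg.kerSubspaceIdeal : Ideal ↥R₁ where
  carrier := K
  add_mem' hx hy := K.add_mem hx hy
  zero_mem' := K.zero_mem
  smul_mem' r _ hx := ArtAlg.mul_mem_kerSubspace p hI K hK r _ hx

/-- Membership: the ideal IS `K`. [cite: Hartshorne2010, §11 Definition (b)] -/
theorem ArtAlg.mem_kerSubspaceIdeal (x : ↥R₁) : x ∈ ArtAlg.kerSubspaceIdeal p hI K hK ↔ x ∈ K :=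
  Iff.rfl

/-- `K ⊆ ker p` as ideals. [cite: Hartshorne2010, §11 Definition (b)] -/
theorem ArtAlg.kerSubspaceIdeal_le_ker : ArtAlg.kerSubspaceIdeal p hI K hK ≤ RingHom.ker p :=
  fun x hx => (ArtAlg.mem_kerSubmodule p x).1 (hK hx)

/-- `K` is a proper ideal. [cite: StacksProject, Tag 06GD] -/
theorem ArtAlg.kerSubspaceIdeal_ne_top : ArtAlg.kerSubspaceIdeal p hI K hK ≠ ⊤ := fun h =>
  RingHom.ker_ne_top p (top_le_iff.1 (h ▸ ArtAlg.kerSubspaceIdeal_le_ker p hI K hK))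

end KerSubspace

/-! ## §2 The quotient datum `p_K : R₁/K → R₀` -/

section KerQuot

variable {k : Type u} [Field k] {R₀ R₁ : ArtAlg.{u} k} (p : R₁ →ₐ[k] R₀) (hI : RingHom.ker p * maximalIdeal R₁ = ⊥)
  (K : Submodule k ↥R₁) (hK : K ≤ ArtAlg.kerSubmodule p)

/-- **`R₁/K` as an object of `Art_k`** (`ArtAlg.ofQuotient`). Definition with body.
[cite: Hartshorne2010, §11 Definition (b) («`0 → J/K → C′/K → C → 0`»)] [cite: StacksProject, Tag 06GC] -/
noncomputable def ArtAlg.kerQuot : ArtAlg.{u} k :=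
  R₁.ofQuotient (ArtAlg.kerSubspaceIdeal p hI K hK) (ArtAlg.kerSubspaceIdeal_ne_top p hI K hK)

/-- The quotient map `q_K : R₁ → R₁/K`. Definition with body. [cite: Hartshorne2010, §11 Definition (b)] -/
noncomputable def ArtAlg.kerQuotMk : ↥R₁ →ₐ[k] (ArtAlg.kerQuot p hI K hK : Type u) :=
  Ideal.Quotient.mkₐ k (ArtAlg.kerSubspaceIdeal p hI K hK)

/-- `q_K` is surjective. [cite: StacksProject, Tag 06GC] -/
theorem ArtAlg.kerQuotMk_surjective : Function.Surjective (ArtAlg.kerQuotMk p hI K hK) :=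
  Ideal.Quotient.mkₐ_surjective k _

/-- `q_K x = 0 ↔ x ∈ K`. [cite: Hartshorne2010, §11 Definition (b)] -/
theorem ArtAlg.kerQuotMk_eq_zero_iff (x : ↥R₁) : ArtAlg.kerQuotMk p hI K hK x = 0 ↔ x ∈ K :=
  Ideal.Quotient.eq_zero_iff_mem

/-- The descended map `p_K : R₁/K → R₀`. Definition with body. [cite: Hartshorne2010, §11 Definition (b)] -/
noncomputable def ArtAlg.kerQuotLift : (ArtAlg.kerQuot p hI K hK : Type u) →ₐ[k] ↥R₀ :=
  Ideal.Quotient.liftₐ (ArtAlg.kerSubspaceIdeal p hI K hK) p fun _ ha =>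
    (RingHom.mem_ker).1 (ArtAlg.kerSubspaceIdeal_le_ker p hI K hK ha)

/-- `p_K (q_K x) = p x`. [cite: Hartshorne2010, §11 Definition (b)] -/
theorem ArtAlg.kerQuotLift_mk (x : ↥R₁) : ArtAlg.kerQuotLift p hI K hK (ArtAlg.kerQuotMk p hI K hK x) = p x :=
  rfl

/-- `p_K ∘ q_K = p`. [cite: Hartshorne2010, §11 Definition (b)] -/
theorem ArtAlg.kerQuotLift_comp_mk : (ArtAlg.kerQuotLift p hI K hK).comp (ArtAlg.kerQuotMk p hI K hK) = p :=
  AlgHom.ext fun x => ArtAlg.kerQuotLift_mk p hI K hK x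

/-- `(q_K, id) : p → p_K` is a morphism of surjection data: `p_K ∘ q_K = id ∘ p`. [cite: Hartshorne2010, §11 Definition (b)]
[cite: FantechiManetti1999T1Lifting, §0 p. 2 (morphisms of small extensions)] -/
theorem ArtAlg.kerQuot_sq :
    (ArtAlg.kerQuotLift p hI K hK).comp (ArtAlg.kerQuotMk p hI K hK) = (AlgHom.id k ↥R₀).comp p := by
  rw [ArtAlg.kerQuotLift_comp_mk, AlgHom.id_comp]

/-- `p_K` is surjective when `p` is. [cite: StacksProject, Tag 06GD] -/
theorem ArtAlg.kerQuotLift_surjective (hp : Function.Surjective p) :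
    Function.Surjective (ArtAlg.kerQuotLift p hI K hK) := fun y => by
  obtain ⟨x, rfl⟩ := hp y
  exact ⟨ArtAlg.kerQuotMk p hI K hK x, ArtAlg.kerQuotLift_mk p hI K hK x⟩

/-- `ker p_K = q_K(ker p)`. [cite: Hartshorne2010, §11 Definition (b) («`J/K`»)] -/
theorem ArtAlg.kerQuotLift_eq_zero_iff (z : (ArtAlg.kerQuot p hI K hK : Type u)) :
    ArtAlg.kerQuotLift p hI K hK z = 0 ↔ ∃ j : ↥(ArtAlg.kerSubmodule p), ArtAlg.kerQuotMk p hI K hK (j : ↥R₁) = z := by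
  constructor
  · intro hz
    obtain ⟨x, rfl⟩ := ArtAlg.kerQuotMk_surjective p hI K hK z
    rw [ArtAlg.kerQuotLift_mk] at hz
    exact ⟨⟨x, (ArtAlg.mem_kerSubmodule p x).2 hz⟩, rfl⟩
  · rintro ⟨j, rfl⟩
    rw [ArtAlg.kerQuotLift_mk]
    exact (ArtAlg.mem_kerSubmodule p _).1 j.2

include hI in
/-- **`ker p_K · 𝔪_{R₁/K} = 0`**: the quotient datum is again small. [cite: Hartshorne2010, §11 Definition (b)]
[cite: StacksProject, Tag 06GD] -/
theorem ArtAlg.ker_kerQuotLift_mul_maximalIdeal :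
    RingHom.ker (ArtAlg.kerQuotLift p hI K hK) * maximalIdeal (ArtAlg.kerQuot p hI K hK : Type u) = ⊥ := by
  rw [eq_bot_iff, Ideal.mul_le]
  intro x hx y hy
  obtain ⟨j, rfl⟩ := (ArtAlg.kerQuotLift_eq_zero_iff p hI K hK x).1 ((RingHom.mem_ker).1 hx)
  obtain ⟨b, rfl⟩ := ArtAlg.kerQuotMk_surjective p hI K hK y
  have hb : b ∈ maximalIdeal R₁ := by
    rw [IsLocalRing.mem_maximalIdeal, mem_nonunits_iff]
    intro hbu
    exact (IsLocalRing.mem_maximalIdeal _).1 hy (hbu.map (ArtAlg.kerQuotMk p hI K hK))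
  have h0 : (j : ↥R₁) * b = 0 := by
    have h := Ideal.mul_mem_mul (RingHom.mem_ker.2 ((ArtAlg.mem_kerSubmodule p _).1 j.2)) hb
    rwa [hI, Ideal.mem_bot] at h
  rw [Ideal.mem_bot, ← map_mul, h0, map_zero]

/-- `p_K` is a small extension (Fantechi–Manetti) when `p` is. [cite: FantechiManetti1999T1Lifting, §0 p. 2]
[cite: Hartshorne2010, §11 Definition (b)] -/
theorem ArtAlg.isSmallExt_kerQuotLift (hp : IsSmallExt k p) : IsSmallExt k (ArtAlg.kerQuotLift p hI K hK) :=
  ⟨ArtAlg.kerQuotLift_surjective p hI K hK hp.surjective, ArtAlg.ker_kerQuotLift_mul_maximalIdeal p hI K hK⟩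

/-- **`ker p → ker p_K`, `j ↦ q_K j`** (`J → J/K`). Definition with body. [cite: Hartshorne2010, §11 Definition (b)] -/
noncomputable def ArtAlg.kerQuotKerMap :
    ↥(ArtAlg.kerSubmodule p) →ₗ[k] ↥(ArtAlg.kerSubmodule (ArtAlg.kerQuotLift p hI K hK)) :=
  (ArtAlg.kerQuotMk p hI K hK).toLinearMap.restrict fun j hj =>
    (ArtAlg.mem_kerSubmodule _ _).2 (by
      rw [AlgHom.toLinearMap_apply, ArtAlg.kerQuotLift_mk]
      exact (ArtAlg.mem_kerSubmodule p j).1 hj)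

/-- On elements `J → J/K` is `q_K`. [cite: Hartshorne2010, §11 Definition (b)] -/
theorem ArtAlg.coe_kerQuotKerMap (j : ↥(ArtAlg.kerSubmodule p)) :
    ((ArtAlg.kerQuotKerMap p hI K hK j : ↥(ArtAlg.kerSubmodule (ArtAlg.kerQuotLift p hI K hK))) :
        (ArtAlg.kerQuot p hI K hK : Type u)) = ArtAlg.kerQuotMk p hI K hK (j : ↥R₁) :=
  rfl

/-- `J → J/K` is surjective. [cite: Hartshorne2010, §11 Definition (b)] -/
theorem ArtAlg.kerQuotKerMap_surjective : Function.Surjective (ArtAlg.kerQuotKerMap p hI K hK) := fun j' => by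
  obtain ⟨j, hj⟩ := (ArtAlg.kerQuotLift_eq_zero_iff p hI K hK (j' : (ArtAlg.kerQuot p hI K hK : Type u))).1
    ((ArtAlg.mem_kerSubmodule _ _).1 j'.2)
  exact ⟨j, Subtype.ext hj⟩

/-- `J → J/K` has kernel `K`. [cite: Hartshorne2010, §11 Definition (b)] -/
theorem ArtAlg.kerQuotKerMap_eq_zero_iff (j : ↥(ArtAlg.kerSubmodule p)) :
    ArtAlg.kerQuotKerMap p hI K hK j = 0 ↔ (j : ↥R₁) ∈ K := by
  rw [← ArtAlg.kerQuotMk_eq_zero_iff p hI K hK, ← ArtAlg.coe_kerQuotKerMap]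
  exact ⟨fun h => by rw [h]; rfl, fun h => Subtype.ext h⟩

end KerQuot

/-! ## §3 Quotient by the kernel of a functional: a principal small extension -/

section Functional

variable {k : Type u} [Field k] {R₀ R₁ : ArtAlg.{u} k} (p : R₁ →ₐ[k] R₀) (hI : RingHom.ker p * maximalIdeal R₁ = ⊥)
  (w : ↥(ArtAlg.kerSubmodule p) →ₗ[k] k)

/-- **`K_w = ker w ⊆ ker p`** for a functional `w` on `J = ker p`, as a subspace of `R₁`. Definition with body.
[cite: Hartshorne2010, §11 Definition (b)] -/
noncomputable def ArtAlg.fnlKer : Submodule k ↥R₁ :=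
  (LinearMap.ker w).map (ArtAlg.kerSubmodule p).subtype

/-- Membership in `K_w`. [cite: Hartshorne2010, §11 Definition (b)] -/
theorem ArtAlg.mem_fnlKer_iff (x : ↥R₁) :
    x ∈ ArtAlg.fnlKer p w ↔ ∃ hx : x ∈ ArtAlg.kerSubmodule p, w ⟨x, hx⟩ = 0 := by
  constructor
  · rintro ⟨j, hj, rfl⟩
    exact ⟨j.2, hj⟩
  · rintro ⟨hx, h⟩
    exact ⟨⟨x, hx⟩, h, rfl⟩

/-- For `j ∈ J`: `j ∈ K_w ↔ w j = 0`. [cite: Hartshorne2010, §11 Definition (b)] -/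
theorem ArtAlg.coe_mem_fnlKer_iff (j : ↥(ArtAlg.kerSubmodule p)) : (j : ↥R₁) ∈ ArtAlg.fnlKer p w ↔ w j = 0 := by
  rw [ArtAlg.mem_fnlKer_iff]
  exact ⟨fun ⟨_, h⟩ => h, fun h => ⟨j.2, h⟩⟩

/-- `K_w ⊆ J`. [cite: Hartshorne2010, §11 Definition (b)] -/
theorem ArtAlg.fnlKer_le : ArtAlg.fnlKer p w ≤ ArtAlg.kerSubmodule p := by
  rintro _ ⟨j, -, rfl⟩
  exact j.2

/-- `R₁/K_w ∈ Art_k`. Definition with body (abbreviation of `ArtAlg.kerQuot`). [cite: Hartshorne2010, §11 Definition (b)] -/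
noncomputable abbrev ArtAlg.fnlQuot : ArtAlg.{u} k :=
  ArtAlg.kerQuot p hI (ArtAlg.fnlKer p w) (ArtAlg.fnlKer_le p w)

/-- `q_w : R₁ → R₁/K_w`. Definition with body (abbreviation). [cite: Hartshorne2010, §11 Definition (b)] -/
noncomputable abbrev ArtAlg.fnlQuotMk : ↥R₁ →ₐ[k] (ArtAlg.fnlQuot p hI w : Type u) :=
  ArtAlg.kerQuotMk p hI (ArtAlg.fnlKer p w) (ArtAlg.fnlKer_le p w)

/-- `p_w : R₁/K_w → R₀`. Definition with body (abbreviation). [cite: Hartshorne2010, §11 Definition (b)] -/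
noncomputable abbrev ArtAlg.fnlQuotLift : (ArtAlg.fnlQuot p hI w : Type u) →ₐ[k] ↥R₀ :=
  ArtAlg.kerQuotLift p hI (ArtAlg.fnlKer p w) (ArtAlg.fnlKer_le p w)

/-- **The class `t̄ = q_w t ∈ ker p_w`** of `t ∈ J`. Definition with body. [cite: Hartshorne2010, §11 Definition (b)]
[cite: Schlessinger1968, Def. 1.2] -/
noncomputable def ArtAlg.fnlGen (t : ↥(ArtAlg.kerSubmodule p)) : ↥(ArtAlg.kerSubmodule (ArtAlg.fnlQuotLift p hI w)) :=
  ArtAlg.kerQuotKerMap p hI (ArtAlg.fnlKer p w) (ArtAlg.fnlKer_le p w) t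

/-- On elements `t̄ = q_w t`. [cite: Hartshorne2010, §11 Definition (b)] -/
theorem ArtAlg.coe_fnlGen (t : ↥(ArtAlg.kerSubmodule p)) :
    ((ArtAlg.fnlGen p hI w t : ↥(ArtAlg.kerSubmodule (ArtAlg.fnlQuotLift p hI w))) : (ArtAlg.fnlQuot p hI w : Type u)) =
      ArtAlg.fnlQuotMk p hI w (t : ↥R₁) :=
  rfl

/-- **`q_w j = w(j) · q_w t` whenever `w t = 1`**: in `J/K_w ≅ k` (via `w`) the class of `j` is `w(j)` times the
generator — the relation `α t₁ = c · t₂` of the base-change lemmas, with `c = w(j)`. [cite: Hartshorne2010, §11 Definition (b)]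
[cite: Schlessinger1968, Def. 1.2] -/
theorem ArtAlg.fnlQuotMk_coe_eq_smul (t : ↥(ArtAlg.kerSubmodule p)) (ht : w t = 1) (j : ↥(ArtAlg.kerSubmodule p)) :
    ArtAlg.fnlQuotMk p hI w (j : ↥R₁) = w j • ArtAlg.fnlQuotMk p hI w (t : ↥R₁) := by
  have h : ((j - w j • t : ↥(ArtAlg.kerSubmodule p)) : ↥R₁) ∈ ArtAlg.fnlKer p w :=
    (ArtAlg.coe_mem_fnlKer_iff p w _).2 (by rw [map_sub, map_smul, ht, smul_eq_mul, mul_one, sub_self])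
  have h2 := (ArtAlg.kerQuotMk_eq_zero_iff p hI _ (ArtAlg.fnlKer_le p w) _).2 h
  rw [Submodule.coe_sub, Submodule.coe_smul, map_sub, map_smul, sub_eq_zero] at h2
  exact h2

/-- `t̄ ≠ 0` when `w t = 1`. [cite: Schlessinger1968, Def. 1.2] -/
theorem ArtAlg.fnlGen_ne_zero (t : ↥(ArtAlg.kerSubmodule p)) (ht : w t = 1) :
    ((ArtAlg.fnlGen p hI w t : ↥(ArtAlg.kerSubmodule (ArtAlg.fnlQuotLift p hI w))) : (ArtAlg.fnlQuot p hI w : Type u)) ≠ 0 := by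
  intro h
  rw [ArtAlg.coe_fnlGen, ArtAlg.kerQuotMk_eq_zero_iff, ArtAlg.coe_mem_fnlKer_iff, ht] at h
  exact one_ne_zero h

/-- `ker p_w = k · t̄` when `w t = 1`. [cite: Schlessinger1968, Def. 1.2] [cite: Hartshorne2010, §11 Definition (b)] -/
theorem ArtAlg.exists_eq_smul_fnlGen (t : ↥(ArtAlg.kerSubmodule p)) (ht : w t = 1)
    (j' : ↥(ArtAlg.kerSubmodule (ArtAlg.fnlQuotLift p hI w))) : ∃ b : k, j' = b • ArtAlg.fnlGen p hI w t := by
  obtain ⟨j, rfl⟩ := ArtAlg.kerQuotKerMap_surjective p hI _ (ArtAlg.fnlKer_le p w) j'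
  refine ⟨w j, Subtype.ext ?_⟩
  rw [ArtAlg.coe_kerQuotKerMap, Submodule.coe_smul, ArtAlg.coe_fnlGen]
  exact ArtAlg.fnlQuotMk_coe_eq_smul p hI w t ht j

/-- **`p_w : R₁/K_w → R₀` is a (principal, Schlessinger) small extension** when `p` is surjective with `ker p · 𝔪 = 0`
and `w t = 1`. [cite: Schlessinger1968, Def. 1.2] [cite: Hartshorne2010, §11 Definition (b)] -/
theorem ArtAlg.isSmallExtension_fnlQuotLift (hp : Function.Surjective p) (t : ↥(ArtAlg.kerSubmodule p)) (ht : w t = 1) :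
    IsSmallExtension k (ArtAlg.fnlQuotLift p hI w) where
  surjective := ArtAlg.kerQuotLift_surjective p hI _ _ hp
  ker_mul_maximalIdeal := ArtAlg.ker_kerQuotLift_mul_maximalIdeal p hI _ _
  exists_ker_eq_span := by
    refine ⟨(ArtAlg.fnlGen p hI w t : (ArtAlg.fnlQuot p hI w : Type u)), ArtAlg.fnlGen_ne_zero p hI w t ht,
      le_antisymm (fun x hx => ?_) ?_⟩
    · obtain ⟨b, hb⟩ := ArtAlg.exists_eq_smul_fnlGen p hI w t ht ⟨x, (ArtAlg.mem_kerSubmodule _ _).2 ((RingHom.mem_ker).1 hx)⟩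
      have hb' : x = b • (ArtAlg.fnlGen p hI w t : (ArtAlg.fnlQuot p hI w : Type u)) := congrArg Subtype.val hb
      rw [hb', Algebra.smul_def]
      exact Ideal.mul_mem_left _ _ (Ideal.subset_span rfl)
    · rw [Ideal.span_le, Set.singleton_subset_iff]
      exact (ArtAlg.mem_kerSubmodule _ _).1 (ArtAlg.fnlGen p hI w t).2

end Functional

/-! ## §4 Functoriality of the quotient data -/

section Map

variable {k : Type u} [Field k] {R₀ R₁ S₀ S₁ : ArtAlg.{u} k}
  (p : R₁ →ₐ[k] R₀) (hI : RingHom.ker p * maximalIdeal R₁ = ⊥) (K : Submodule k ↥R₁) (hK : K ≤ ArtAlg.kerSubmodule p)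
  (p₂ : S₁ →ₐ[k] S₀) (h₂ : RingHom.ker p₂ * maximalIdeal S₁ = ⊥) (K₂ : Submodule k ↥S₁) (hK₂ : K₂ ≤ ArtAlg.kerSubmodule p₂)
  (α : ↥R₁ →ₐ[k] ↥S₁) (ᾱ : ↥R₀ →ₐ[k] ↥S₀) (hsq : p₂.comp α = ᾱ.comp p) (hα : ∀ x ∈ K, α x ∈ K₂)

/-- **The descended map `R₁/K → S₁/K₂`** of a morphism `α` with `α(K) ⊆ K₂`. Definition with body.
[cite: FantechiManetti1999T1Lifting, §0 p. 2] [cite: Hartshorne2010, §11 Definition (b)] -/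
noncomputable def ArtAlg.kerQuotMap : (ArtAlg.kerQuot p hI K hK : Type u) →ₐ[k] (ArtAlg.kerQuot p₂ h₂ K₂ hK₂ : Type u) :=
  Ideal.Quotient.liftₐ (ArtAlg.kerSubspaceIdeal p hI K hK) ((ArtAlg.kerQuotMk p₂ h₂ K₂ hK₂).comp α) fun a ha =>
    (ArtAlg.kerQuotMk_eq_zero_iff p₂ h₂ K₂ hK₂ _).2 (hα a ha)

/-- On classes: `ᾱ_K (q_K x) = q_{K₂} (α x)`. [cite: FantechiManetti1999T1Lifting, §0 p. 2] -/
theorem ArtAlg.kerQuotMap_mk (x : ↥R₁) :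
    ArtAlg.kerQuotMap p hI K hK p₂ h₂ K₂ hK₂ α hα (ArtAlg.kerQuotMk p hI K hK x) = ArtAlg.kerQuotMk p₂ h₂ K₂ hK₂ (α x) :=
  rfl

/-- The square with the quotient maps. [cite: FantechiManetti1999T1Lifting, §0 p. 2] -/
theorem ArtAlg.kerQuotMap_comp_mk :
    (ArtAlg.kerQuotMap p hI K hK p₂ h₂ K₂ hK₂ α hα).comp (ArtAlg.kerQuotMk p hI K hK) =
      (ArtAlg.kerQuotMk p₂ h₂ K₂ hK₂).comp α :=
  AlgHom.ext fun x => ArtAlg.kerQuotMap_mk p hI K hK p₂ h₂ K₂ hK₂ α hα x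

include hsq in
/-- The square with the descended surjections: `p₂,K₂ ∘ ᾱ_K = ᾱ ∘ p_K` — a morphism of surjection data
`(ᾱ_K, ᾱ) : p_K → p₂,K₂`. [cite: FantechiManetti1999T1Lifting, §0 p. 2] [cite: Hartshorne2010, §11 Definition (b)] -/
theorem ArtAlg.kerQuotLift_comp_kerQuotMap :
    (ArtAlg.kerQuotLift p₂ h₂ K₂ hK₂).comp (ArtAlg.kerQuotMap p hI K hK p₂ h₂ K₂ hK₂ α hα) =
      ᾱ.comp (ArtAlg.kerQuotLift p hI K hK) := by
  refine Ideal.Quotient.algHom_ext k (AlgHom.ext fun x => ?_)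
  change ArtAlg.kerQuotLift p₂ h₂ K₂ hK₂ (ArtAlg.kerQuotMap p hI K hK p₂ h₂ K₂ hK₂ α hα (ArtAlg.kerQuotMk p hI K hK x)) =
    ᾱ (ArtAlg.kerQuotLift p hI K hK (ArtAlg.kerQuotMk p hI K hK x))
  rw [ArtAlg.kerQuotMap_mk, ArtAlg.kerQuotLift_mk, ArtAlg.kerQuotLift_mk]
  exact AlgHom.congr_fun hsq x

include hsq in
/-- Composite squares: `p₃ ∘ (β ∘ α) = (β' ∘ ᾱ) ∘ p₁`. [cite: FantechiManetti1999T1Lifting, §0 p. 2] -/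
theorem ArtAlg.comp_sq {T₀ T₁ : ArtAlg.{u} k} (p₃ : T₁ →ₐ[k] T₀) (β : ↥S₁ →ₐ[k] ↥T₁) (β' : ↥S₀ →ₐ[k] ↥T₀)
    (hsq' : p₃.comp β = β'.comp p₂) : p₃.comp (β.comp α) = (β'.comp ᾱ).comp p := by
  rw [← AlgHom.comp_assoc, hsq', AlgHom.comp_assoc, hsq, ← AlgHom.comp_assoc]

include hsq in
/-- The square `p → p₂,K₂` along `q_{K₂} ∘ α` over `ᾱ`. [cite: Hartshorne2010, §11 Definition (b)] -/
theorem ArtAlg.kerQuotLift_comp_mk_comp :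
    (ArtAlg.kerQuotLift p₂ h₂ K₂ hK₂).comp ((ArtAlg.kerQuotMk p₂ h₂ K₂ hK₂).comp α) = ᾱ.comp p := by
  rw [← AlgHom.comp_assoc, ArtAlg.kerQuotLift_comp_mk, hsq]

/-- When `α(ker p) ⊆ K₂`, the morphism `q_{K₂} ∘ α` KILLS the kernel of `p` (a square with zero kernel map).
[cite: Hartshorne2010, §11 Definition (b)] -/
theorem ArtAlg.kerQuotMk_comp_apply_eq_zero (hα0 : ∀ j : ↥(ArtAlg.kerSubmodule p), α (j : ↥R₁) ∈ K₂) (j : ↥R₁)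
    (hj : j ∈ RingHom.ker p) : ((ArtAlg.kerQuotMk p₂ h₂ K₂ hK₂).comp α) j = 0 :=
  (ArtAlg.kerQuotMk_eq_zero_iff p₂ h₂ K₂ hK₂ _).2 (hα0 ⟨j, (ArtAlg.mem_kerSubmodule p j).2 hj⟩)

variable (g : ↥(ArtAlg.kerSubmodule p) →ₗ[k] ↥(ArtAlg.kerSubmodule p₂))
  (hg : ∀ j, ((g j : ↥(ArtAlg.kerSubmodule p₂)) : ↥S₁) = α j) (w₂ : ↥(ArtAlg.kerSubmodule p₂) →ₗ[k] k)

include hg in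
/-- `α(K_{w₂ ∘ g}) ⊆ K_{w₂}` for the kernel map `g = α|_J : J → J₂`. [cite: Hartshorne2010, §11 Definition (b)] -/
theorem ArtAlg.map_mem_fnlKer (x : ↥R₁) (hx : x ∈ ArtAlg.fnlKer p (w₂ ∘ₗ g)) : α x ∈ ArtAlg.fnlKer p₂ w₂ := by
  obtain ⟨hx, h⟩ := (ArtAlg.mem_fnlKer_iff p _ x).1 hx
  have hmem : α x ∈ ArtAlg.kerSubmodule p₂ := by
    rw [← hg ⟨x, hx⟩]
    exact (g ⟨x, hx⟩).2
  refine (ArtAlg.mem_fnlKer_iff p₂ w₂ _).2 ⟨hmem, ?_⟩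
  have e : (⟨α x, hmem⟩ : ↥(ArtAlg.kerSubmodule p₂)) = g ⟨x, hx⟩ := Subtype.ext (hg ⟨x, hx⟩).symm
  rw [e]
  exact h

/-- **`ᾱ_w : R₁/K_{w₂ ∘ g} → S₁/K_{w₂}`**. Definition with body (abbreviation of `kerQuotMap`).
[cite: Hartshorne2010, §11 Definition (b)] [cite: FantechiManetti1999T1Lifting, §0 p. 2] -/
noncomputable abbrev ArtAlg.fnlQuotMap :
    (ArtAlg.fnlQuot p hI (w₂ ∘ₗ g) : Type u) →ₐ[k] (ArtAlg.fnlQuot p₂ h₂ w₂ : Type u) :=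
  ArtAlg.kerQuotMap p hI (ArtAlg.fnlKer p (w₂ ∘ₗ g)) (ArtAlg.fnlKer_le p _) p₂ h₂ (ArtAlg.fnlKer p₂ w₂)
    (ArtAlg.fnlKer_le p₂ w₂) α (ArtAlg.map_mem_fnlKer p p₂ α g hg w₂)

include hg in
/-- **Generator relation `ᾱ_w t̄₁ = w₂(g t₁) · t̄₂`** (`w₂ t₂ = 1`); in particular `= 1 · t̄₂` when `w₂(g t₁) = 1`.
[cite: Hartshorne2010, §11 Definition (b)] [cite: Schlessinger1968, Def. 1.2] -/
theorem ArtAlg.fnlQuotMap_coe_fnlGen (t₁ : ↥(ArtAlg.kerSubmodule p)) (t₂ : ↥(ArtAlg.kerSubmodule p₂)) (ht₂ : w₂ t₂ = 1) :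
    ArtAlg.fnlQuotMap p hI p₂ h₂ α g hg w₂
        ((ArtAlg.fnlGen p hI (w₂ ∘ₗ g) t₁ : ↥(ArtAlg.kerSubmodule (ArtAlg.fnlQuotLift p hI (w₂ ∘ₗ g)))) :
          (ArtAlg.fnlQuot p hI (w₂ ∘ₗ g) : Type u)) =
      w₂ (g t₁) • ((ArtAlg.fnlGen p₂ h₂ w₂ t₂ : ↥(ArtAlg.kerSubmodule (ArtAlg.fnlQuotLift p₂ h₂ w₂))) :
        (ArtAlg.fnlQuot p₂ h₂ w₂ : Type u)) := by
  rw [ArtAlg.coe_fnlGen, ArtAlg.coe_fnlGen, ArtAlg.kerQuotMap_mk, ← hg, ArtAlg.fnlQuotMk_coe_eq_smul p₂ h₂ w₂ t₂ ht₂ (g t₁)]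

end Map

/-! ## §5 Squares of square-zero kernel rings -/

section Squares

variable {k : Type u} [Field k] {R₀ R₁ R₂ R₃ R₄ R₅ : ArtAlg.{u} k}

/-- **`k[J″ → J] = k[J′ → J] ∘ k[J″ → J′]`** for composable squares. [cite: Schlessinger1968, (2.16)–(2.17), p. 213] -/
theorem ArtAlg.sqZeroKerMap_comp (p₁ : R₁ →ₐ[k] R₀) (h₁ : RingHom.ker p₁ * maximalIdeal R₁ = ⊥) (p₂ : R₃ →ₐ[k] R₂)
    (h₂ : RingHom.ker p₂ * maximalIdeal R₃ = ⊥) (p₃ : R₅ →ₐ[k] R₄) (h₃ : RingHom.ker p₃ * maximalIdeal R₅ = ⊥)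
    (α : ↥R₁ →ₐ[k] ↥R₃) (ᾱ : ↥R₀ →ₐ[k] ↥R₂) (hsq : p₂.comp α = ᾱ.comp p₁) (β : ↥R₃ →ₐ[k] ↥R₅) (β' : ↥R₂ →ₐ[k] ↥R₄)
    (hsq' : p₃.comp β = β'.comp p₂) (hsq'' : p₃.comp (β.comp α) = (β'.comp ᾱ).comp p₁) :
    (ArtAlg.sqZeroKerMap p₃ h₃ p₂ h₂ β β' hsq').comp (ArtAlg.sqZeroKerMap p₂ h₂ p₁ h₁ α ᾱ hsq) =
      ArtAlg.sqZeroKerMap p₃ h₃ p₁ h₁ (β.comp α) (β'.comp ᾱ) hsq'' :=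
  AlgHom.ext fun _ => Subtype.ext rfl

/-- **A square whose kernel map vanishes induces `k[J′] → k → k[J]`** (`x = c · 1 + j ↦ c · 1`).
[cite: Schlessinger1968, (2.16)–(2.17), p. 213] [cite: Hartshorne2010, §11 Definition (b)] -/
theorem ArtAlg.sqZeroKerMap_eq_inl_comp_aug (p : R₁ →ₐ[k] R₀) (hI : RingHom.ker p * maximalIdeal R₁ = ⊥)
    (p' : R₃ →ₐ[k] R₂) (hI' : RingHom.ker p' * maximalIdeal R₃ = ⊥) (aug₃ : ↥R₃ →ₐ[k] k) (q' : ↥R₃ →ₐ[k] ↥R₁)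
    (q : ↥R₂ →ₐ[k] ↥R₀) (hsq : p.comp q' = q.comp p') (hq : ∀ j : ↥R₃, j ∈ RingHom.ker p' → q' j = 0) :
    ArtAlg.sqZeroKerMap p hI p' hI' q' q hsq = (ArtAlg.sqZeroKerInl p hI).comp (ArtAlg.sqZeroKerAug p' hI' aug₃) := by
  refine AlgHom.ext fun x => Subtype.ext ?_
  obtain ⟨c, i, hi, hx⟩ :=
    (ArtAlg.mem_sqZeroKer_iff p' (ArtAlg.sqZeroKerVal p' hI' x)).1 (show ↥(ArtAlg.sqZeroKerSubalgebra p') from x).2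
  have hi0 : aug₃ i = 0 := by
    have h : i ∈ RingHom.ker (aug₃ : ↥R₃ →+* k) := by
      rw [ArtAlg.ker_augmentation_eq_maximalIdeal]
      exact IsLocalRing.le_maximalIdeal (RingHom.ker_ne_top _) hi
    exact h
  change q' (ArtAlg.sqZeroKerVal p' hI' x) = algebraMap k R₁ (aug₃ (ArtAlg.sqZeroKerVal p' hI' x))
  rw [hx, map_add, AlgHom.commutes, hq i hi, add_zero, map_add, hi0, add_zero, AlgHom.commutes,
    Algebra.algebraMap_self, RingHom.id_apply]

end Squares

/-! ## §6 Coordinate lines `k[ε] → R₁` through the elements of `ker p`, and scalings of `k[ε]` -/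

section Lines

variable {k : Type u} [Field k] {R₀ R₁ : ArtAlg.{u} k} (p : R₁ →ₐ[k] R₀) (hI : RingHom.ker p * maximalIdeal R₁ = ⊥)

/-- The structure morphism `k → R` from the object `k` of `Art_k`. Definition with body. [cite: Schlessinger1968, §1 p. 208] -/
noncomputable def ArtAlg.ofBase (R : ArtAlg.{u} k) : (ArtAlg.base k : Type u) →ₐ[k] ↥R :=
  Algebra.ofId k ↥R

/-- **The coordinate line `λ_i : k[ε] → R₁`, `a + bε ↦ a · 1 + b i`** through `i ∈ ker p` (Schlessinger's line
`k[ε] → k[J]` followed by `k[J] ⊆ R₁`). Definition with body. [cite: Schlessinger1968, (2.17), p. 213 («we identify `V` with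
`Hom(k[ε], k[V])`»)] -/
noncomputable def ArtAlg.kerLineHom (i : ↥(ArtAlg.kerSubmodule p)) : (ArtAlg.sqZeroExt (k := k) k : Type u) →ₐ[k] ↥R₁ :=
  (ArtAlg.sqZeroKerVal p hI).comp (ArtAlg.sqZeroKerLine p hI i)

/-- `λ_i (a + bε) = a · 1 + b i`. [cite: Schlessinger1968, (2.17), p. 213] -/
theorem ArtAlg.kerLineHom_apply (i : ↥(ArtAlg.kerSubmodule p)) (x : (ArtAlg.sqZeroExt (k := k) k : Type u)) :
    ArtAlg.kerLineHom p hI i x = algebraMap k R₁ x.fst + ((x.snd • i : ↥(ArtAlg.kerSubmodule p)) : ↥R₁) :=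
  ArtAlg.sqZeroKerVal_sqZeroKerLine p hI i x

/-- `λ_i ε = i`. [cite: Schlessinger1968, (2.17), p. 213] -/
theorem ArtAlg.kerLineHom_eps (i : ↥(ArtAlg.kerSubmodule p)) :
    ArtAlg.kerLineHom p hI i (ArtAlg.epsKer k : (ArtAlg.sqZeroExt (k := k) k : Type u)) = i := by
  change ArtAlg.kerLineHom p hI i ArtAlg.sqZeroExtEps = i
  rw [ArtAlg.kerLineHom_apply, ArtAlg.fst_sqZeroExtEps, ArtAlg.snd_sqZeroExtEps, map_zero, zero_add, one_smul]

/-- **`(λ_i, k → R₀)` is a morphism of surjection data `(k[ε] → k) → (R₁ → R₀)`**: `p ∘ λ_i = (k → R₀) ∘ (k[ε] → k)`.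
[cite: Schlessinger1968, (2.17), p. 213] [cite: FantechiManetti1999T1Lifting, §0 p. 2] -/
theorem ArtAlg.kerLineHom_sq (i : ↥(ArtAlg.kerSubmodule p)) :
    p.comp (ArtAlg.kerLineHom p hI i) = (ArtAlg.ofBase R₀).comp (ArtAlg.sqZeroExtAug (k := k) k) := by
  refine AlgHom.ext fun x => ?_
  change p (ArtAlg.kerLineHom p hI i x) = algebraMap k R₀ x.fst
  rw [ArtAlg.kerLineHom_apply, map_add, AlgHom.commutes, (ArtAlg.mem_kerSubmodule p _).1 (x.snd • i).2, add_zero]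

/-- **`k[λ_i] ∘ (k[ε] → k[kε], ε ↦ ε) = ` Schlessinger's line `k[ε] → k[J]` through `i`**: the square-zero kernel map of
the square `(λ_i, k → R₀)`, read on the model `k[ε]`, is `a + bε ↦ a + b i`. [cite: Schlessinger1968, (2.17), p. 213]
[cite: StacksProject, Tag 06IT] -/
theorem ArtAlg.sqZeroKerMap_kerLineHom_comp_sqZeroKerLine_epsKer (i : ↥(ArtAlg.kerSubmodule p)) :
    (ArtAlg.sqZeroKerMap p hI (ArtAlg.sqZeroExtAug (k := k) k) (ArtAlg.ker_sqZeroExtAug_mul_maximalIdeal k)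
          (ArtAlg.kerLineHom p hI i) (ArtAlg.ofBase R₀) (ArtAlg.kerLineHom_sq p hI i)).comp
        (ArtAlg.sqZeroKerLine (ArtAlg.sqZeroExtAug (k := k) k) (ArtAlg.ker_sqZeroExtAug_mul_maximalIdeal k)
          (ArtAlg.epsKer k)) =
      ArtAlg.sqZeroKerLine p hI i := by
  refine TrivSqZeroExt.algHom_ext fun m => Subtype.ext ?_
  change ArtAlg.kerLineHom p hI i (ArtAlg.sqZeroKerVal _ _ (ArtAlg.sqZeroKerLine (ArtAlg.sqZeroExtAug (k := k) k)
      (ArtAlg.ker_sqZeroExtAug_mul_maximalIdeal k) (ArtAlg.epsKer k) (TrivSqZeroExt.inr m))) =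
    ArtAlg.sqZeroKerVal p hI (ArtAlg.sqZeroKerLine p hI i (TrivSqZeroExt.inr m))
  rw [ArtAlg.sqZeroKerVal_sqZeroKerLine, ArtAlg.sqZeroKerVal_sqZeroKerLine, TrivSqZeroExt.fst_inr,
    TrivSqZeroExt.snd_inr, map_zero, zero_add, map_zero, zero_add, Submodule.coe_smul, Submodule.coe_smul, map_smul,
    ArtAlg.kerLineHom_eps]

/-- **The scaling `σ_c : k[ε] → k[ε]`, `ε ↦ c ε`** (`k[b ↦ c b]`). Definition with body.
[cite: Schlessinger1968, Lemma 2.10, p. 212 («scalar multiplication by `a ∈ k` … induced by the endomorphism `b ↦ ab` of `V`»)] -/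
noncomputable def ArtAlg.epsScale (c : k) :
    (ArtAlg.sqZeroExt (k := k) k : Type u) →ₐ[k] (ArtAlg.sqZeroExt (k := k) k : Type u) :=
  ArtAlg.sqZeroExtMap (k := k) (c • LinearMap.id)

/-- `σ_c` fixes the `k`-component. [cite: Schlessinger1968, Lemma 2.10, p. 212] -/
theorem ArtAlg.fst_epsScale (c : k) (x : (ArtAlg.sqZeroExt (k := k) k : Type u)) : (ArtAlg.epsScale c x).fst = x.fst := by
  rw [ArtAlg.epsScale, ArtAlg.sqZeroExtMap_apply, TrivSqZeroExt.fst_map]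

/-- `σ_c` multiplies the `ε`-component by `c`. [cite: Schlessinger1968, Lemma 2.10, p. 212] -/
theorem ArtAlg.snd_epsScale (c : k) (x : (ArtAlg.sqZeroExt (k := k) k : Type u)) :
    (ArtAlg.epsScale c x).snd = c * x.snd := by
  rw [ArtAlg.epsScale, ArtAlg.sqZeroExtMap_apply, TrivSqZeroExt.snd_map, LinearMap.smul_apply, LinearMap.id_apply,
    smul_eq_mul]

/-- `σ_c` is a morphism of surjection data over `id_k`: `(k[ε] → k) ∘ σ_c = id ∘ (k[ε] → k)`.
[cite: Schlessinger1968, Lemma 2.10, p. 212] -/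
theorem ArtAlg.epsScale_sq (c : k) :
    (ArtAlg.sqZeroExtAug (k := k) k).comp (ArtAlg.epsScale c) =
      (AlgHom.id k (ArtAlg.base k : Type u)).comp (ArtAlg.sqZeroExtAug (k := k) k) := by
  refine AlgHom.ext fun x => ?_
  change (ArtAlg.epsScale c x).fst = x.fst
  exact ArtAlg.fst_epsScale c x

/-- Generator relation `σ_c ε = c · ε`. [cite: Schlessinger1968, Lemma 2.10, p. 212] -/
theorem ArtAlg.epsScale_eps (c : k) :
    ArtAlg.epsScale c (ArtAlg.epsKer k : (ArtAlg.sqZeroExt (k := k) k : Type u)) =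
      c • (ArtAlg.epsKer k : (ArtAlg.sqZeroExt (k := k) k : Type u)) := by
  change (ArtAlg.epsScale c ArtAlg.sqZeroExtEps : TrivSqZeroExt k k) =
    @HSMul.hSMul k (TrivSqZeroExt k k) (TrivSqZeroExt k k) _ c ArtAlg.sqZeroExtEps
  refine TrivSqZeroExt.ext ?_ ?_
  · rw [ArtAlg.fst_epsScale, TrivSqZeroExt.fst_smul, ArtAlg.fst_sqZeroExtEps, smul_zero]
  · rw [ArtAlg.snd_epsScale, TrivSqZeroExt.snd_smul, ArtAlg.snd_sqZeroExtEps, smul_eq_mul]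

/-- **`λ_i ∘ σ_c = λ_{c i}`**. [cite: Schlessinger1968, Lemma 2.10 and (2.17), pp. 212–213] -/
theorem ArtAlg.kerLineHom_comp_epsScale (i : ↥(ArtAlg.kerSubmodule p)) (c : k) :
    (ArtAlg.kerLineHom p hI i).comp (ArtAlg.epsScale c) = ArtAlg.kerLineHom p hI (c • i) := by
  refine AlgHom.ext fun x => ?_
  change ArtAlg.kerLineHom p hI i (ArtAlg.epsScale c x) = ArtAlg.kerLineHom p hI (c • i) x
  rw [ArtAlg.kerLineHom_apply, ArtAlg.kerLineHom_apply, ArtAlg.fst_epsScale, ArtAlg.snd_epsScale, mul_comm, mul_smul]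

variable (w : ↥(ArtAlg.kerSubmodule p) →ₗ[k] k)

/-- **Generator relation of the composite `k[ε] —λ_i→ R₁ —q_w→ R₁/K_w`: `ε ↦ w(i) · t̄`** (`w t = 1`).
[cite: Hartshorne2010, §11 Definition (b)] [cite: Schlessinger1968, (2.17), p. 213] -/
theorem ArtAlg.fnlQuotMk_comp_kerLineHom_eps (t : ↥(ArtAlg.kerSubmodule p)) (ht : w t = 1)
    (i : ↥(ArtAlg.kerSubmodule p)) :
    ((ArtAlg.fnlQuotMk p hI w).comp (ArtAlg.kerLineHom p hI i)) (ArtAlg.epsKer k : (ArtAlg.sqZeroExt (k := k) k : Type u)) =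
      w i • ((ArtAlg.fnlGen p hI w t : ↥(ArtAlg.kerSubmodule (ArtAlg.fnlQuotLift p hI w))) :
        (ArtAlg.fnlQuot p hI w : Type u)) := by
  rw [AlgHom.comp_apply, ArtAlg.kerLineHom_eps, ArtAlg.coe_fnlGen]
  exact ArtAlg.fnlQuotMk_coe_eq_smul p hI w t ht i

/-- The composite square `(q_w ∘ λ_i, k → R₀) : (k[ε] → k) → (R₁/K_w → R₀)`. [cite: Hartshorne2010, §11 Definition (b)] -/
theorem ArtAlg.fnlQuotLift_comp_fnlQuotMk_comp_kerLineHom (i : ↥(ArtAlg.kerSubmodule p)) :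
    (ArtAlg.fnlQuotLift p hI w).comp ((ArtAlg.fnlQuotMk p hI w).comp (ArtAlg.kerLineHom p hI i)) =
      ((AlgHom.id k ↥R₀).comp (ArtAlg.ofBase R₀)).comp (ArtAlg.sqZeroExtAug (k := k) k) :=
  ArtAlg.comp_sq (ArtAlg.sqZeroExtAug (k := k) k) p (ArtAlg.kerLineHom p hI i) (ArtAlg.ofBase R₀)
    (ArtAlg.kerLineHom_sq p hI i) (ArtAlg.fnlQuotLift p hI w) (ArtAlg.fnlQuotMk p hI w) (AlgHom.id k ↥R₀)
    (ArtAlg.kerQuot_sq p hI _ _)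

end Lines

end Literature.AlgebraicGeometry.Deformation
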